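import Summits.QuantumFields.YangMills.Theorems.UnitScaleTiltProp7FaceFluxT3
import Summits.QuantumFields.YangMills.Theorems.UnitScaleTiltProp7BondAvgIterCoercivity
import Summits.QuantumFields.YangMills.Theorems.UnitScaleTiltProp7TentInterpolation
import HarnessLib

/-!
# Route `UnitScaleTilt`, crux K1 «MinimiserStabilityRegPr» (stmt-QuantumFields-19200), line «route-R» (`Lines/birth_routeR.lean` v2 5b75208179c6919a),
# stub P `stub_relPoincareOpt` — linear flat core P-lin-flat, step N7 (ASSEMBLY, CARD-19200-V3-g11 §5) PART 1: THE REAL, ONE-COMPONENT CORE —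
# from the constraint `ℓ·(Q_kB)(c) + (g(c₊) − g(c₋)) = r(c)` on a divergence-free real `B`, the face-flux split (N5) and the flat engine (I3):
# `‖B‖² ≤ 12ℓ·Σ_c r(c)² + (81/8)ℓ²·Σ_p (∂B)(p)²` and `Σ_c (g(c₊) − g(c₋))² ≤ 2Σ_c r(c)² + 2ℓ·Σ_p (∂B)(p)²` (`ℓ = L^k`, `d = 3`); plus the
# Dirichlet∕tent step (N3∘N4): `‖∂λ‖² ≤ ℓ·Σ_c (λ(y′₀) − λ(y₀))²`

Cell `ym3-torus`, width seat `ym-ust-20520-w2` (g2), σ-4 (N7) taker (OWNER 02:44:01Z).  THEOREMS ONLY (0 `def`, 0 `sorry`); `--supports stmt-QuantumFields-19200`,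
count-neutral.  YM₃ on T³ is a ladder rung (R3), not the Clay problem; nothing here claims P, the stub, the crux or the gap.

SETTING.  `P : Params` with `d = 3`, fine torus `Site P 0`, coarse level `k ≤ m + K` (`h := Prop7FlatCoercivity.sitesPerDir_zero_eq_pow_mul hk`), `ℓ = (L : ℝ)^k`;
`Q_k = LatticeFieldCalculus.bondAvgIter k` (= the straight-line block mean, `Prop7FlatCoercivity.bondAvgIter_eq_lineBlockAvg_real`).  The matrix∕component layering
of the N7 SPEC is done in PART 2 (`…Prop7PinnedFlatCoercivity`); here everything is REAL.

WHAT IS PROVED (ns `…Theorems.Prop7PinnedFlatCoercivityReal`).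
* §1 `coarse_split_algebra` — Step 4's algebra on any finite index type: `ℓM + G = r`, `M = F + E`, `Σ G·F = 0` ⇒ `ΣG² ≤ 2Σr² + 2ℓ²ΣE²`, `Σ(ℓM)² ≤ 6Σr² + 4ℓ²ΣE²`.
* §2 `diag_grad_sq_le_curl_add_diverg` — `Σ_μ Σ_x (B(x+e_μ, μ) − B(x, μ))² ≤ Σ_p (∂B)(p)² + Σ_x (∂^*B)(x)²` (the diagonal part of [Balaban1984PropagatorsI] (1.21)).
* §3 ★★ `sum_sq_le_of_constraint` — THE ONE-COMPONENT CORE displayed in the title (Steps 4–5 for `B`: N5 (ii)(iii) `…Prop7FaceFluxLineMean`, I3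
  `Prop7FlatCoercivity.sum_sq_le_bondAvgIter_add_curl_add_diverg`, §1, §2).
* §4 ★ `grad_sq_le_of_dirichlet` — Step 5 for `∂λ`: if `λ` minimises the Dirichlet energy among site functions with the same values at the `k`-centres
  `embIter k y`, then `‖∂λ‖² ≤ ℓ^{d−2}·Σ_c (λ(embIter k c₊) − λ(embIter k c₋))²` (N4 `Prop7TentInterpolation.exists_tentInterpolant_grad`).
* §5 ★★ `component_bound` — §3 + §4 for a Hodge pair `X = B + ∂λ` (`∂^*B = 0`, `∂B = ∂X`): `‖B‖² + ‖∂λ‖² ≤ 14ℓ·Σ_c r² + (97/8)ℓ²·Σ_p (∂X)(p)²`.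

References: T. Bałaban, CMP 95 (1984) 17–40 [Balaban1984PropagatorsI] (Prop. 1.1 (1.90) p.33, (1.18)–(1.21) pp.20–21); CMP 102 (1985) 277–309 [Balaban1985Variational]
(Prop. 7 p.299).
-/

noncomputable section

open scoped BigOperators

namespace Summit.QuantumFields.YangMills.Theorems.Prop7PinnedFlatCoercivityReal

open Literature.MathematicalPhysics.QuantumFieldTheory.Balaban1983to89
open Finset LatticeFieldCalculus
open B10StarCount (sum_pbond)
open B15DeterminingSets (embIter)
open Summit.QuantumFields.YangMills.Theorems.Prop7FlatCoercivity (sitesPerDir_zero_eq_pow_mul bondAvgIter_eq_lineBlockAvg_real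
  sum_sq_le_bondAvgIter_add_curl_add_diverg sum_grad_sq_eq_curl_add_diverg)
open Summit.QuantumFields.YangMills.Theorems.Prop7FaceFluxLineMean (sum_faceLayer_mul_coarseGrad_eq_zero sum_sq_lineMean_sub_faceMean_le)
open Summit.QuantumFields.YangMills.Theorems.Prop7TentInterpolation (exists_tentInterpolant_grad)

variable {P : Params}

/-! ## §1 Step 4's algebra: orthogonal splitting of the constraint -/

/-- **THE COARSE-SPLIT ALGEBRA**: on a finite index set, if `ℓ·M + G = r`, `M = F + E` and `Σ G·F = 0`, then `Σ G² ≤ 2Σ r² + 2ℓ²Σ E²` and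
`Σ (ℓM)² ≤ 6Σ r² + 4ℓ²Σ E²`. [folklore] -/
theorem coarse_split_algebra {ι : Type*} [Fintype ι] (ℓ : ℝ) (M F E G r : ι → ℝ)
    (hM : ∀ c, M c = F c + E c) (hcons : ∀ c, ℓ * M c + G c = r c) (horth : ∑ c, G c * F c = 0) :
    ∑ c, G c ^ 2 ≤ 2 * ∑ c, r c ^ 2 + 2 * ℓ ^ 2 * ∑ c, E c ^ 2 ∧
      ∑ c, (ℓ * M c) ^ 2 ≤ 6 * ∑ c, r c ^ 2 + 4 * ℓ ^ 2 * ∑ c, E c ^ 2 := by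
  have hG : ∀ c, G c = (r c - ℓ * E c) - ℓ * F c := by
    intro c; have h1 := hcons c; rw [hM c] at h1; linarith
  -- `Σ G² = Σ G (r − ℓE) − ℓ Σ G F = Σ G (r − ℓE)`
  have hsq : ∑ c, G c ^ 2 = ∑ c, G c * (r c - ℓ * E c) := by
    have h1 : ∑ c, G c ^ 2 = ∑ c, (G c * (r c - ℓ * E c) - ℓ * (G c * F c)) := by
      refine Finset.sum_congr rfl fun c _ => ?_
      have h2 : G c * G c = G c * ((r c - ℓ * E c) - ℓ * F c) := by rw [← hG c]
      rw [sq, h2]; ring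
    rw [h1, Finset.sum_sub_distrib, ← Finset.mul_sum, horth, mul_zero, sub_zero]
  -- AM–GM pointwise
  have hamgm : ∑ c, G c * (r c - ℓ * E c) ≤ ∑ c, (G c ^ 2 / 2 + (r c - ℓ * E c) ^ 2 / 2) :=
    Finset.sum_le_sum fun c _ => by nlinarith [sq_nonneg (G c - (r c - ℓ * E c))]
  have hsplit : ∑ c, (G c ^ 2 / 2 + (r c - ℓ * E c) ^ 2 / 2) = (∑ c, G c ^ 2) / 2 + (∑ c, (r c - ℓ * E c) ^ 2) / 2 := by
    rw [Finset.sum_add_distrib, Finset.sum_div, Finset.sum_div]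
  have hre : ∑ c, (r c - ℓ * E c) ^ 2 ≤ 2 * ∑ c, r c ^ 2 + 2 * ℓ ^ 2 * ∑ c, E c ^ 2 := by
    rw [Finset.mul_sum, Finset.mul_sum, ← Finset.sum_add_distrib]
    exact Finset.sum_le_sum fun c _ => by nlinarith [sq_nonneg (r c + ℓ * E c)]
  have hG2 : ∑ c, G c ^ 2 ≤ 2 * ∑ c, r c ^ 2 + 2 * ℓ ^ 2 * ∑ c, E c ^ 2 := by
    have h1 : ∑ c, G c ^ 2 ≤ (∑ c, G c ^ 2) / 2 + (∑ c, (r c - ℓ * E c) ^ 2) / 2 := by rw [hsq] at *; linarith [hamgm, hsplit]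
    linarith
  refine ⟨hG2, ?_⟩
  -- `ℓM = r − G`
  have hM2 : ∑ c, (ℓ * M c) ^ 2 ≤ 2 * ∑ c, r c ^ 2 + 2 * ∑ c, G c ^ 2 := by
    rw [Finset.mul_sum, Finset.mul_sum, ← Finset.sum_add_distrib]
    refine Finset.sum_le_sum fun c _ => ?_
    have h1 : ℓ * M c = r c - G c := by linarith [hcons c]
    rw [h1]; nlinarith [sq_nonneg (r c + G c)]
  linarith

/-! ## §2 The diagonal part of the gradient form -/

/-- `Σ_μ Σ_x (B(x+e_μ, μ) − B(x, μ))² ≤ Σ_b Σ_ν (B(b+e_ν) − B(b))² = Σ_p (∂B)(p)² + Σ_x (∂^*B)(x)²` (diagonal terms of (1.21)). [cite: Balaban1984PropagatorsI, (1.21) p.21] -/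
theorem diag_grad_sq_le_curl_add_diverg {i : ℕ} (B : VecField P i ℝ) :
    ∑ μ : Fin P.d, ∑ x : Site P i, (B ⟨x.shift μ, μ⟩ - B ⟨x, μ⟩) ^ 2
      ≤ ∑ p : Plaq P i, (curl 1 B p) ^ 2 + ∑ x : Site P i, (diverg 1 B x) ^ 2 := by
  rw [← sum_grad_sq_eq_curl_add_diverg B, sum_pbond, Finset.sum_comm]
  refine Finset.sum_le_sum fun x _ => Finset.sum_le_sum fun μ _ => ?_
  exact Finset.single_le_sum (f := fun ν : Fin P.d => (B ⟨x.shift ν, μ⟩ - B ⟨x, μ⟩) ^ 2) (fun ν _ => sq_nonneg _) (Finset.mem_univ μ)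

/-! ## §3 ★★ The one-component core -/

/-- ★★ **THE ONE-COMPONENT CORE OF N7** (`d = 3`, `ℓ = L^k`): for a real divergence-free bond field `B` on the finest torus, a coarse site function `g` and a
coarse bond function `r` with the constraint `ℓ·(Q_kB)(c) + (g(c₊) − g(c₋)) = r(c)` at every level-`k` bond,
`Σ_b B(b)² ≤ 12ℓ·Σ_c r(c)² + (81/8)ℓ²·Σ_p (∂B)(p)²` and `Σ_c (g(c₊) − g(c₋))² ≤ 2Σ_c r(c)² + 2ℓ·Σ_p (∂B)(p)²`.
Steps 4–5 of the SPEC: `Q_kB = F + E` with `F` the face mean (⊥ coarse gradients, N5 (ii)) and `Σ E² ≤ ℓ^{−1}·(diagonal gradient form)` (N5 (iii)); the algebra of §1;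
the flat engine I3 with `∂^*B = 0`. [cite: Balaban1984PropagatorsI, Prop. 1.1 (1.90) p.33, (1.18)–(1.21) pp.20–21] -/
theorem sum_sq_le_of_constraint (hd : P.d = 3) {k : ℕ} (hk : k ≤ P.m + P.K) (B : VecField P 0 ℝ) (hB : diverg 1 B = 0)
    (g : Site P k → ℝ) (r : PBond P k → ℝ)
    (hcons : ∀ c : PBond P k, (P.L : ℝ) ^ k * bondAvgIter k B c + (g c.tgt - g c.src) = r c) :
    ∑ b : PBond P 0, B b ^ 2
        ≤ 12 * (P.L : ℝ) ^ k * ∑ c : PBond P k, r c ^ 2 + (81 / 8) * ((P.L : ℝ) ^ k) ^ 2 * ∑ p : Plaq P 0, (curl 1 B p) ^ 2 ∧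
      ∑ c : PBond P k, (g c.tgt - g c.src) ^ 2 ≤ 2 * ∑ c : PBond P k, r c ^ 2 + 2 * (P.L : ℝ) ^ k * ∑ p : Plaq P 0, (curl 1 B p) ^ 2 := by
  classical
  have h := sitesPerDir_zero_eq_pow_mul (P := P) hk
  have hLpos : (0 : ℝ) < (P.L : ℝ) := by exact_mod_cast P.L_pos
  have hℓ : (0 : ℝ) < (P.L : ℝ) ^ k := pow_pos hLpos k
  have hV : ((P.L : ℝ) ^ k) ^ P.d = ((P.L : ℝ) ^ k) ^ 3 := by rw [hd]
  -- the letters of the split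
  set ℓ : ℝ := (P.L : ℝ) ^ k with hℓdef
  set M : PBond P k → ℝ := fun c => bondAvgIter k B c with hMdef
  set FS : PBond P k → ℝ := fun c => ∑ x ∈ univ.filter (fun x : Site P 0 =>
      Site.proj k k x = c.src ∧ (x c.dir).val % P.L ^ k + 1 = P.L ^ k), B ⟨x, c.dir⟩ with hFSdef
  set F : PBond P k → ℝ := fun c => ℓ * (ℓ ^ P.d)⁻¹ * FS c with hFdef
  set E : PBond P k → ℝ := fun c => M c - F c with hEdef
  set G : PBond P k → ℝ := fun c => g c.tgt - g c.src with hGdef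
  set D : ℝ := ∑ μ : Fin P.d, ∑ x : Site P 0, (B ⟨x.shift μ, μ⟩ - B ⟨x, μ⟩) ^ 2 with hDdef
  set C2 : ℝ := ∑ p : Plaq P 0, (curl 1 B p) ^ 2 with hC2def
  -- (ii): `Σ G·F = 0`
  have horth : ∑ c, G c * F c = 0 := by
    have h0 := sum_faceLayer_mul_coarseGrad_eq_zero h (c₀ := (1 : ℝ)) one_ne_zero hB g
    have h1 : ∑ c, G c * F c = ℓ * (ℓ ^ P.d)⁻¹ * ∑ c : PBond P k, (g c.tgt - g c.src) * FS c := by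
      rw [Finset.mul_sum]
      refine Finset.sum_congr rfl fun c _ => ?_
      simp only [hGdef, hFdef]; ring
    rw [h1, h0, mul_zero]
  -- (iii): `Σ E² ≤ ℓ²(ℓ^d)⁻¹·D`
  have hE : ∑ c, E c ^ 2 ≤ ℓ ^ 2 * (ℓ ^ P.d)⁻¹ * D := by
    have h3 := sum_sq_lineMean_sub_faceMean_le h B
    have hEq : ∀ c : PBond P k, E c = (((P.L : ℝ) ^ k) ^ P.d * (P.L : ℝ) ^ k)⁻¹
            * ∑ x ∈ univ.filter (fun x : Site P 0 => Site.proj k k x = c.src), ∑ t ∈ range (P.L ^ k),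
                B ⟨(fun z : Site P 0 => z.shift c.dir)^[t] x, c.dir⟩
          - (P.L : ℝ) ^ k * (((P.L : ℝ) ^ k) ^ P.d)⁻¹
            * ∑ x ∈ univ.filter (fun x : Site P 0 => Site.proj k k x = c.src ∧ (x c.dir).val % P.L ^ k + 1 = P.L ^ k), B ⟨x, c.dir⟩ := by
      intro c
      simp only [hEdef, hMdef, hFdef, hFSdef, hℓdef]
      rw [bondAvgIter_eq_lineBlockAvg_real hk B c]
    simp only [hEq]
    exact h3
  -- `D ≤ curl² + div² = curl²`
  have hD : D ≤ C2 := by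
    have h1 := diag_grad_sq_le_curl_add_diverg B
    have h2 : ∑ x : Site P 0, (diverg 1 B x) ^ 2 = 0 := by
      simp only [hB, Pi.zero_apply]; simp
    rw [h2, add_zero] at h1
    exact h1
  -- the engine with `∂^*B = 0`
  have hI3 : ∑ b : PBond P 0, B b ^ 2 ≤ 2 * ℓ ^ P.d * ∑ c, M c ^ 2 + (17 / 8) * ℓ ^ 2 * C2 := by
    have h1 := sum_sq_le_bondAvgIter_add_curl_add_diverg hk B
    have h2 : ∑ x : Site P 0, (diverg 1 B x) ^ 2 = 0 := by
      simp only [hB, Pi.zero_apply]; simp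
    rw [h2, add_zero] at h1
    exact h1
  -- §1
  have hcons' : ∀ c, ℓ * M c + G c = r c := fun c => hcons c
  have hMFE : ∀ c, M c = F c + E c := fun c => by simp only [hEdef]; ring
  obtain ⟨hG2, hM2⟩ := coarse_split_algebra ℓ M F E G r hMFE hcons' horth
  -- numerics at `d = 3`
  have hℓE : ℓ ^ 2 * ∑ c, E c ^ 2 ≤ ℓ * C2 := by
    calc ℓ ^ 2 * ∑ c, E c ^ 2 ≤ ℓ ^ 2 * (ℓ ^ 2 * (ℓ ^ P.d)⁻¹ * D) := mul_le_mul_of_nonneg_left hE (by positivity)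
      _ = ℓ * D := by rw [hV]; field_simp
      _ ≤ ℓ * C2 := mul_le_mul_of_nonneg_left hD hℓ.le
  have hD0 : 0 ≤ D := by positivity
  refine ⟨?_, by linarith⟩
  calc ∑ b : PBond P 0, B b ^ 2 ≤ 2 * ℓ ^ P.d * ∑ c, M c ^ 2 + (17 / 8) * ℓ ^ 2 * C2 := hI3
    _ = 2 * ℓ * ∑ c, (ℓ * M c) ^ 2 + (17 / 8) * ℓ ^ 2 * C2 := by
        rw [hV]
        simp only [mul_pow, ← Finset.mul_sum]
        ring
    _ ≤ 2 * ℓ * (6 * ∑ c, r c ^ 2 + 4 * ℓ ^ 2 * ∑ c, E c ^ 2) + (17 / 8) * ℓ ^ 2 * C2 := by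
        have : 0 ≤ 2 * ℓ := by positivity
        nlinarith [hM2]
    _ ≤ 2 * ℓ * (6 * ∑ c, r c ^ 2 + 4 * (ℓ * C2)) + (17 / 8) * ℓ ^ 2 * C2 := by
        have : 0 ≤ 2 * ℓ := by positivity
        nlinarith [hℓE]
    _ = 12 * ℓ * ∑ c, r c ^ 2 + (81 / 8) * ℓ ^ 2 * C2 := by ring

/-! ## §4 ★ Step 5 for the gradient part: Dirichlet principle + tent interpolation -/

/-- ★ **THE PINNED DIRICHLET MINIMISER IS CONTROLLED BY ITS CENTRE VALUES**: if `λ` has least Dirichlet energy among the site functions agreeing with it at the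
`k`-centres `embIter k y`, then `Σ_b (∂λ)(b)² ≤ ℓ^{d−2}·Σ_c (λ(embIter k c₊) − λ(embIter k c₋))²` (compare with the tent interpolant of N4).
[cite: Balaban1984PropagatorsI, (1.18) p.20] -/
theorem grad_sq_le_of_dirichlet {k : ℕ} (hk : k ≤ P.m + P.K) (lam : SiteField P 0 ℝ)
    (hDir : ∀ ψ : SiteField P 0 ℝ, (∀ x ∈ Set.range (embIter (P := P) k), ψ x = lam x) →
      ∑ e : PBond P 0, (grad 1 lam e) ^ 2 ≤ ∑ e : PBond P 0, (grad 1 ψ e) ^ 2) :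
    ∑ e : PBond P 0, (grad 1 lam e) ^ 2
      ≤ ((P.L : ℝ) ^ k) ^ (P.d - 2) * ∑ c : PBond P k, (lam (embIter k c.tgt) - lam (embIter k c.src)) ^ 2 := by
  obtain ⟨ψ, hψ, hE⟩ := exists_tentInterpolant_grad k hk 1 (fun y : Site P k => lam (embIter k y))
  have hagree : ∀ x ∈ Set.range (embIter (P := P) k), ψ x = lam x := by
    rintro x ⟨y, rfl⟩; exact hψ y
  refine (hDir ψ hagree).trans (hE.trans (le_of_eq ?_))
  congr 1
  refine Finset.sum_congr rfl fun c _ => ?_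
  simp only [grad, one_smul]

/-! ## §5 ★★ One component of the Hodge pair -/

/-- `∂(X − ∂λ) = ∂X` (the curl kills gradients). [cite: Balaban1984PropagatorsI, (1.4) p.18] -/
theorem curl_sub_grad (X : VecField P 0 ℝ) (lam : SiteField P 0 ℝ) (p : Plaq P 0) :
    curl 1 (fun e : PBond P 0 => X e - grad 1 lam e) p = curl 1 X p := by
  have h := curl_grad (P := P) (j := 0) 1 1 lam p
  simp only [curl, smul_eq_mul, one_mul] at h ⊢
  linarith

/-- ★★ **ONE REAL COMPONENT OF N7** (`d = 3`, `ℓ = L^k`): for a Hodge pair `X = B + ∂λ` on the finest torus (`B := X − ∂λ`, `∂^*B = 0`), `λ` Dirichlet-minimal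
given its centre values, `g(y) = λ(embIter k y)`, and the constraint `ℓ·(Q_kB)(c) + (g(c₊) − g(c₋)) = r(c)`:
`Σ_b B(b)² + Σ_b (∂λ)(b)² ≤ 14ℓ·Σ_c r(c)² + (97/8)ℓ²·Σ_p (∂X)(p)²`. [cite: Balaban1985Variational, Prop. 7 p.299] -/
theorem component_bound (hd : P.d = 3) {k : ℕ} (hk : k ≤ P.m + P.K) (X : VecField P 0 ℝ) (lam : SiteField P 0 ℝ)
    (hB : diverg 1 (fun e : PBond P 0 => X e - grad 1 lam e) = 0)
    (hDir : ∀ ψ : SiteField P 0 ℝ, (∀ x ∈ Set.range (embIter (P := P) k), ψ x = lam x) →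
      ∑ e : PBond P 0, (grad 1 lam e) ^ 2 ≤ ∑ e : PBond P 0, (grad 1 ψ e) ^ 2)
    (r : PBond P k → ℝ)
    (hcons : ∀ c : PBond P k, (P.L : ℝ) ^ k * bondAvgIter k (fun e : PBond P 0 => X e - grad 1 lam e) c
      + (lam (embIter k c.tgt) - lam (embIter k c.src)) = r c) :
    ∑ b : PBond P 0, (X b - grad 1 lam b) ^ 2 + ∑ b : PBond P 0, (grad 1 lam b) ^ 2
      ≤ 14 * (P.L : ℝ) ^ k * ∑ c : PBond P k, r c ^ 2 + (97 / 8) * ((P.L : ℝ) ^ k) ^ 2 * ∑ p : Plaq P 0, (curl 1 X p) ^ 2 := by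
  have hLpos : (0 : ℝ) < (P.L : ℝ) := by exact_mod_cast P.L_pos
  have hℓ : (0 : ℝ) < (P.L : ℝ) ^ k := pow_pos hLpos k
  obtain ⟨h1, h2⟩ := sum_sq_le_of_constraint hd hk (fun e : PBond P 0 => X e - grad 1 lam e) hB (fun y => lam (embIter k y)) r hcons
  have hcurl : ∑ p : Plaq P 0, (curl 1 (fun e : PBond P 0 => X e - grad 1 lam e) p) ^ 2 = ∑ p : Plaq P 0, (curl 1 X p) ^ 2 :=
    Finset.sum_congr rfl fun p _ => by rw [curl_sub_grad]
  rw [hcurl] at h1 h2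
  have h3 := grad_sq_le_of_dirichlet hk lam hDir
  rw [hd] at h3
  norm_num at h3
  have hC0 : 0 ≤ ∑ p : Plaq P 0, (curl 1 X p) ^ 2 := Finset.sum_nonneg fun p _ => sq_nonneg _
  have h4 : ∑ b : PBond P 0, (grad 1 lam b) ^ 2 ≤ (P.L : ℝ) ^ k * (2 * ∑ c : PBond P k, r c ^ 2 + 2 * (P.L : ℝ) ^ k * ∑ p : Plaq P 0, (curl 1 X p) ^ 2) :=
    h3.trans (mul_le_mul_of_nonneg_left h2 hℓ.le)
  nlinarith [h1, h4, hℓ.le, hC0]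

end Summit.QuantumFields.YangMills.Theorems.Prop7PinnedFlatCoercivityReal

end
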